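import Summits.AtomisticToContinuum.FouriersLaw.Theorems.LocalOhmBVLocalOhmStubEquilibriumPackageAux4
import Summits.AtomisticToContinuum.FouriersLaw.Theorems.EmbeddedDrudeMourreDrudeDissolutionStubPencilFrameworkDynamics
import Literature.MathematicalPhysics.KineticTheory.InfiniteChainCurrentMoments
import Literature.MathematicalPhysics.KineticTheory.InfiniteChainPartialMomentumReversal
import Literature.MathematicalPhysics.KineticTheory.InfiniteChainTightRegular

/-!
# Statics of bond currents against window observables under the shift-invariant Gibbs state

Helper NA `gibbs_window_current_statics` (cycle-2 calibration of the rigidity half at the harmonic corner)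
of the birth line `registered` of crux `LocalOhmBV.LocalOhm` (item stmt-AtomisticToContinuum-12009).
For the pinned chain `P = pinnedChain ω₂ lam β γ` with `ω₂ > 0`, `lam, β ≥ 0` (the harmonic corner
`lam = β = 0` included), `T > 0`, and a shift-invariant DLR Gibbs state `μ` at temperature `T`:

* (i) every bond current `j_z = -½ (p_z + p_{z+1}) V'(q_{z+1} - q_z)` is in `L²(μ)` (the state obeys
  Buttà–Marchioro's superstability estimate, `isShiftInvariant_and_hasSuperstabilityEstimate_of_tight_pinnedChain`,
  and `V` is an even non-negative polynomial of degree `2` or `4`,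
  `GramPencilHarmonicChaos.exists_isEvenPolyOfDegree_V_pinnedChain`) and has mean zero (`j_z` is odd under the
  reversal of the momenta at `{z, z+1}`, which preserves every DLR state);
* (ii) every window observable `g ∘ box_{a,n}` with `g` continuous of polynomial growth is in `L²(μ)` (its square
  is again such an observable, `integrable_comp_boxRestrictAt_of_polyBound`), so `g(box) · j_z ∈ L¹(μ)` (Hölder);
* (iii) if the bond `{z, z+1}` does not meet the box `{a, …, a+n}` then `∫ g(box_{a,n}) j_z dμ = 0`: the partial
  momentum reversal at `{z, z+1}` fixes every coordinate the window reads and flips the sign of `j_z`.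

Folklore; no definitions, no named facts.
-/

set_option autoImplicit false

noncomputable section

namespace Summit.AtomisticToContinuum.FouriersLaw.Theorems.LocalOhmBirth

open MeasureTheory Filter Topology
open scoped BigOperators
open Literature.MathematicalPhysics.KineticTheory
open Literature.MathematicalPhysics.KineticTheory.HeatConduction

/-! ## Partial momentum reversal off the window -/

/-- **Currents on bonds off the window are orthogonal to window observables, for every DLR state of every
chain.** If the bond `{z, z+1}` does not meet the box `{a, …, a+n}` (`z + 1 < a` or `a + n < z`), then
`∫ g(box_{a,n} σ) j_z(σ) dμ = 0` for any `g` (no integrability needed: the integrand is odd under the reversal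
of the momenta at `{z, z+1}`, which fixes `box_{a,n}` and preserves `μ`). [folklore] -/
theorem integral_comp_boxRestrictAt_mul_bondCurrentZ_eq_zero {P : OscillatorChain} {T : ℝ}
    {μ : Measure ChainConfig} (hμ : P.IsChainGibbsMeasure T μ) (a : ℤ) (n : ℕ)
    (g : (Fin (n + 1) → ℝ × ℝ) → ℝ) {z : ℤ} (hz : z + 1 < a ∨ a + (n : ℤ) < z) :
    ∫ σ, g (boxRestrictAt a n σ) * P.bondCurrentZ σ z ∂μ = 0 := by
  refine integral_eq_zero_of_momentumReversalOn_odd (hμ.map_momentumReversalOn {z, z + 1}) fun σ => ?_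
  have hbox : boxRestrictAt a n (momentumReversalOn {z, z + 1} σ) = boxRestrictAt a n σ := by
    funext i
    rw [boxRestrictAt_apply, boxRestrictAt_apply]
    refine momentumReversalOn_apply_not_mem σ ?_
    have hi : (i : ℕ) < n + 1 := i.isLt
    simp only [Finset.mem_insert, Finset.mem_singleton, not_or]
    constructor <;> omega
  rw [hbox, P.bondCurrentZ_momentumReversalOn_of_mem σ (by simp) (by simp)]
  ring

/-! ## Square integrability under the shift-invariant Gibbs state of the pinned chain -/

variable {ω₂ lam β : ℝ}

/-- **The bond currents of the shift-invariant Gibbs state of the pinned chain are square integrable**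
(`ω₂ > 0`, `lam, β ≥ 0`, `T > 0`): the state satisfies Buttà–Marchioro's superstability estimate, under which
`j_z ∈ L^p` for every `p < ∞`. [folklore] -/
theorem memLp_two_bondCurrentZ_of_isShiftInvariant (γ : ℝ) (hω : 0 < ω₂) (hl : 0 ≤ lam) (hβ : 0 ≤ β)
    {T : ℝ} (hT : 0 < T) {μ : Measure ChainConfig} (hμ : (pinnedChain ω₂ lam β γ).IsChainGibbsMeasure T μ)
    (hS : IsShiftInvariant μ) (z : ℤ) :
    MemLp (fun σ => (pinnedChain ω₂ lam β γ).bondCurrentZ σ z) 2 μ := by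
  haveI : IsProbabilityMeasure μ := hμ.isProbabilityMeasure
  have hss : (pinnedChain ω₂ lam β γ).HasSuperstabilityEstimate μ :=
    (OscillatorChain.isShiftInvariant_and_hasSuperstabilityEstimate_of_tight_pinnedChain γ hω hl hβ hT hμ
      (oneSiteTight_of_isShiftInvariant hS)).2
  obtain ⟨s₂, hs₂, hV⟩ :=
    DrudeDissolution.GramPencilHarmonicChaos.exists_isEvenPolyOfDegree_V_pinnedChain ω₂ lam γ hβ
  exact hss.memLp_bondCurrentZ hs₂ (OscillatorChain.pinnedChain_U_nonneg β γ hω.le hl)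
    (OscillatorChain.measurable_pinnedChain_U ω₂ lam β γ) hV z ENNReal.ofNat_ne_top

/- Maintenance note (build repair 2026-08-20; no statement changed): the next lemma lives in the
sub-namespace `LocalOhmBirth.CurrentStatics` (opened right after it) because the sibling helper file
`LocalOhmBVLocalOhmCalibrationWindowClustering.lean` declares the same name in `LocalOhmBirth`, so that the
two modules could not be imported together (the `Summits` root aggregate: "environment already contains
`…LocalOhmBirth.memLp_two_comp_boxRestrictAt_of_polyBound`"). -/
namespace CurrentStatics

/-- **Window observables of polynomial growth are square integrable** under the shift-invariant Gibbs state
of the pinned chain (`ω₂ > 0`, `lam, β ≥ 0`, `T > 0`): `g²` is continuous of polynomial growth, hence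
integrable by `integrable_comp_boxRestrictAt_of_polyBound`. [folklore] -/
theorem memLp_two_comp_boxRestrictAt_of_polyBound (γ : ℝ) (hω : 0 < ω₂) (hl : 0 ≤ lam) (hβ : 0 ≤ β)
    {T : ℝ} (hT : 0 < T) {μ : Measure ChainConfig} (hμ : (pinnedChain ω₂ lam β γ).IsChainGibbsMeasure T μ)
    (hS : IsShiftInvariant μ) (a : ℤ) (n : ℕ) {g : (Fin (n + 1) → ℝ × ℝ) → ℝ} (hg : Continuous g)
    (hb : ∃ (C₀ : ℝ) (m : ℕ), ∀ y, |g y| ≤ C₀ * (1 + ‖y‖) ^ m) :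
    MemLp (g ∘ boxRestrictAt a n) 2 μ := by
  obtain ⟨C₀, m, hle⟩ := hb
  have hI2 : Integrable (fun σ => (g ^ 2) (boxRestrictAt a n σ)) μ :=
    integrable_comp_boxRestrictAt_of_polyBound γ hω hl hβ hT hμ hS a n (hg.pow 2) ⟨C₀ ^ 2, 2 * m,
      fun y => by
        rw [Pi.pow_apply, abs_pow, pow_mul', ← mul_pow]
        exact pow_le_pow_left₀ (abs_nonneg _) (hle y) 2⟩
  exact (memLp_two_iff_integrable_sq
    ((hg.measurable.comp (boxRestrictAt_measurable a n)).aestronglyMeasurable)).2 hI2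

end CurrentStatics

open Summit.AtomisticToContinuum.FouriersLaw.Theorems.LocalOhmBirth.CurrentStatics

/-- **Window observables times bond currents are integrable** under the shift-invariant Gibbs state of the
pinned chain (both factors are in `L²`). [folklore] -/
theorem integrable_comp_boxRestrictAt_mul_bondCurrentZ (γ : ℝ) (hω : 0 < ω₂) (hl : 0 ≤ lam) (hβ : 0 ≤ β)
    {T : ℝ} (hT : 0 < T) {μ : Measure ChainConfig} (hμ : (pinnedChain ω₂ lam β γ).IsChainGibbsMeasure T μ)
    (hS : IsShiftInvariant μ) (a : ℤ) (n : ℕ) {g : (Fin (n + 1) → ℝ × ℝ) → ℝ} (hg : Continuous g)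
    (hb : ∃ (C₀ : ℝ) (m : ℕ), ∀ y, |g y| ≤ C₀ * (1 + ‖y‖) ^ m) (z : ℤ) :
    Integrable (fun σ => g (boxRestrictAt a n σ) * (pinnedChain ω₂ lam β γ).bondCurrentZ σ z) μ :=
  (memLp_two_comp_boxRestrictAt_of_polyBound γ hω hl hβ hT hμ hS a n hg hb).integrable_mul
    (memLp_two_bondCurrentZ_of_isShiftInvariant γ hω hl hβ hT hμ hS z)

/-! ## The registered helper -/

/-- **NA (statics of currents against window observables)** for the shift-invariant Gibbs state of
`pinnedChain ω₂ lam β γ` (`ω₂ > 0`, `lam, β ≥ 0`, `T > 0`): (i) `j_z ∈ L²(μ)` and `∫ j_z dμ = 0`; (ii) for a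
continuous window profile `g` of polynomial growth on `{a, …, a+n}`, `g ∘ box_{a,n} ∈ L²(μ)`, every
`g(box_{a,n}) · j_z` is integrable, and (iii) `∫ g(box_{a,n}) j_z dμ = 0` whenever the bond `{z, z+1}` does not
meet the box. [folklore] -/
theorem gibbs_window_current_statics :
    ∀ ω₂ lam β γ : ℝ, 0 < ω₂ → 0 ≤ lam → 0 ≤ β → ∀ T : ℝ, 0 < T →
    ∀ μ : Measure ChainConfig, (pinnedChain ω₂ lam β γ).IsChainGibbsMeasure T μ → IsShiftInvariant μ →
    (∀ z : ℤ, MemLp (fun σ => (pinnedChain ω₂ lam β γ).bondCurrentZ σ z) 2 μ ∧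
      ∫ σ, (pinnedChain ω₂ lam β γ).bondCurrentZ σ z ∂μ = 0) ∧
    (∀ (a : ℤ) (n : ℕ) (g : (Fin (n + 1) → ℝ × ℝ) → ℝ), Continuous g →
      (∃ (C₀ : ℝ) (m : ℕ), ∀ y, |g y| ≤ C₀ * (1 + ‖y‖) ^ m) →
      MemLp (g ∘ boxRestrictAt a n) 2 μ ∧
      (∀ z : ℤ, Integrable (fun σ => g (boxRestrictAt a n σ) * (pinnedChain ω₂ lam β γ).bondCurrentZ σ z) μ) ∧
      (∀ z : ℤ, (z + 1 < a ∨ a + (n : ℤ) < z) →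
        ∫ σ, g (boxRestrictAt a n σ) * (pinnedChain ω₂ lam β γ).bondCurrentZ σ z ∂μ = 0)) := by
  intro ω₂ lam β γ hω hl hβ T hT μ hμ hS
  refine ⟨fun z => ⟨memLp_two_bondCurrentZ_of_isShiftInvariant γ hω hl hβ hT hμ hS z,
    hμ.integral_bondCurrentZ_eq_zero z⟩, fun a n g hg hb => ⟨?_, ?_, ?_⟩⟩
  · exact memLp_two_comp_boxRestrictAt_of_polyBound γ hω hl hβ hT hμ hS a n hg hb
  · exact fun z => integrable_comp_boxRestrictAt_mul_bondCurrentZ γ hω hl hβ hT hμ hS a n hg hb z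
  · exact fun z hz => integral_comp_boxRestrictAt_mul_bondCurrentZ_eq_zero hμ a n g hz

end Summit.AtomisticToContinuum.FouriersLaw.Theorems.LocalOhmBirth

end
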